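import Literature.MathematicalPhysics.QuantumFieldTheory.Balaban1983to89.B11SupSize190
import Literature.MathematicalPhysics.QuantumFieldTheory.Balaban1983to89.B8Ineq132

/-!
# `Balaban1983to89.B11SeminormSize190` — T. Bałaban, *The variational problem and background fields in renormalization group
# method for lattice gauge theories*, Commun. Math. Phys. **102** (1985) 277–309 [Balaban1985Variational] = "[15]", Sect. G
# (190) p. 308: the OUTPUT sizes of (190) — *"|(δ/δB_ν(y′))𝓗_μ(B,x)|, |∇_x(δ/δB_ν(y′))𝓗_μ(B,x)|, … for x ∈ Δ(y)"* — as
# `B11SectG.BlockNorm`s built from ANY family of seminorms (one per block), in particular the FIRST-ORDER size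
# *"sup_{x∈Δ(y)} |∇_x · |"* with the covariant derivative (1.1) p. 76 of [Balaban1985RegularSpaces] = "[14]" on the cell's
# `ℤ^d` carriers: the DERIVATIVE-SIZE half of the block-size ↔ lattice-value DICTIONARY of the (190)-knitting programme
# (cell GAPS.md G-B15-r12-08 addendum / G-B14-08), completing `B11SupSize190` (the function-size half)

statement-level skeleton of published theorems with citation tags; proofs where landed; nothing here is a claim
about the Yang–Mills mass gap

CITATION HEADER (lean-in-tree rule 2026-08-18).  T. Bałaban, *The variational problem and background fields in
renormalization group method for lattice gauge theories*, Commun. Math. Phys. **102**, 277–309 (1985),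
doi:10.1007/bf01229381, bib `Balaban1985Variational` (cell paper B11; PDF held `paper:balaban1985-cmp102-variational-background`,
journal page = PDF page + 276; p. 308 [PDF 32], x2 render `b2b-balaban-ref1/pages/1985-cmp102-variational-background/…-p032-x2.png`,
quoted from `B11SectG`/`B11StarDecay190`).  "[14]" = T. Bałaban, CMP **99** (1985) 75–102 [Balaban1985RegularSpaces], (1.1)
p. 76 (the covariant derivatives, tree `B8Ineq132.covDerivFwd`).  "[3]" = [Balaban1984PropagatorsII] (2.51)–(2.52) p. 232.

WHAT IS REPRODUCED.  The vocabulary item of [15] (190) p. 308, verbatim: *"|(δ/δB_ν(y′))𝓗_μ(B,x)|, |∇_x(δ/δB_ν(y′))𝓗_μ(B,x)|,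
‖ζ∇(δ/δB(y′))𝓗(B)‖_β, |D^{η*}_{U_k}D^η_{U_k}(δ/δB_ν(y))𝓗_μ(B,x)|, |Δ^η_{U_k}(δ/δB_ν(y′))𝓗_μ(B,x)| ≤ O(1)[(L^jη)^{−1}, (L^jη)^{−2}, …]
·(L^{j′}η)^{−d} exp(−⅛δ₀d(y,y′))  (190)  for x ∈ Δ(y), or supp ζ ⊂ Δ̃(y), y ∈ Λ_j, y′ ∈ Λ_{j′}"* — every entry is "a seminorm of
the function (δ/δB)𝓗, taken at the points of the block Δ(y)"; [14] (1.1) p. 76: *"(D^η_{U,μ}F)(x) = η⁻¹(R(U(x, x + ηe_μ))F(x + ηe_μ) −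
F(x))"*.  SKELETON rows served: B11.Eq190 (vocabulary) and the derivative dictionary hypotheses `hdomD₁,₂` of rows B14.Claim@265
((3.7)/(3.8), `B14Ineq38From190` / `B14From190SupSize.ineq38_lt_lattice_of_ineq190_sup`) and B15.Eq1.31 (`B15Ineq131From190`).
Mega-formalization `lit-balaban`, HOME `run/shared/lean/pub/lit-balaban/`, unit `lit-balaban-r11` gen 7 (B14 fold owner).

THE POINT (kernel-checked; why GAPS G-B15-r12-08's "second obstacle" does not bind).  The obstacle recorded there is real for
sizes whose `cut` is the sharp RESTRICTION: `loc y (cut y f) ≤ κ·loc y f` fails for a derivative sup-size because restricting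
creates jumps.  But the OUTPUT size of (190) enters `B11SectG.HasMaj`/`Ineq190` and every consumer (`B12Ineq45.loc_dH_le_of_ineq190*`,
`B15HDecayLeaves.loc_le_*`, all `…From190` files) ONLY through `loc` and its seminorm axioms (`loc_nonneg/zero/add_le/neg`) —
the partition of unity `cut`/`IsLoc` is used on the INPUT (argument-field) size only.  Hence any family of `ℝ`-seminorms
`p : g.Site → Seminorm ℝ F` is an admissible output size once paired with the TRIVIAL partition (`cut y₀ = id`, `cut y = 0`
otherwise; κ = 1), for which all `BlockNorm` axioms hold: `ofSeminorms g y₀ p`.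

WHAT THIS FILE DEFINES AND PROVES (zero `sorry`; definitions with bodies + proved API; no new `Prop`-valued fact).
* `ofSeminorms g y₀ p : BlockNorm g F` for ANY `ℝ`-module `F`, base block `y₀` and family `p : g.Site → Seminorm ℝ F`
  (`loc y = p y`, trivial partition, κ = 1), all axioms PROVED; `ofSeminorms_loc` (unfolding); `le_ofSeminorms_sup_loc` (for
  `p y = (S y).sup q`, a finite sup of seminorms: `i ∈ S y → q i f ≤ loc y f` — Mathlib `Seminorm.le_finset_sup_apply`).
* `covDerivFwdLM ξ U₀ (x, μ, ν)` — [14]'s forward covariant derivative `f ↦ (∇^ξ_{U₀,μ} f_ν)(x)` (`B8Ineq132.covDerivFwd`) as an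
  `ℝ`-LINEAR functional of the bond field `f : Site d → Fin d → 𝔸` at a FIXED background `U₀` (linearity PROVED);
  `covDerivSeminorm ξ U₀ t = ‖covDerivFwdLM ξ U₀ t ·‖`; `covDerivSize S ξ U₀ = max_{t∈S}` of these (a `Seminorm`).
* `covDerivBlockSize g y₀ S ξ U₀ : BlockNorm g (Site d → Fin d → 𝔸)` — **the first-order output size of (190)**
  *"sup_{x∈Δ(y)}|∇_x ·|"* for the covariant derivative at the background `U₀` over a finite set `S y` of derivative points
  `(x, μ, ν)` per block; and THE DICTIONARY LEMMA `norm_covDerivFwd_le_loc`: `(x, μ, ν) ∈ S y →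
  ‖(∇^ξ_{U₀,μ} f_ν)(x)‖ ≤ (covDerivBlockSize g y₀ S ξ U₀).loc y f` — exactly the shape of the consumers' `hdomD`.
HONEST SCOPE.  A MODEL of the first-order entry's output size (weight `(L^jη)^{−2}` absorbed into the constant `C` of
`B11SectG.Ineq190`; print's Δ(y) ↦ the finite point sets `S y`); the higher entries (Hölder, second order) are further
seminorm families `ofSeminorms` accommodates but are not spelled out; whether `Ineq190 bB (covDerivBlockSize …) dH C δ₀` HOLDS is
[15] Prop. 9, a hypothesis of every consumer, untouched.  Value = the derivative-size dictionary turned from a hypothesis kind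
into a lemma; NOT summit progress.
-/

open scoped NNReal

namespace Literature.MathematicalPhysics.QuantumFieldTheory.Balaban1983to89.B11SeminormSize190

open Literature.MathematicalPhysics.QuantumFieldTheory.Balaban1983to89
open B11SectG B11SupSize190

/-! ## §1 Any family of seminorms is an output size (trivial partition) -/

section OfSeminorms

variable {g : B6.Geometry} {F : Type} [AddCommGroup F] [Module ℝ F]

open scoped Classical in
/-- **Output sizes of (190) from seminorms.**  For a family `p : g.Site → Seminorm ℝ F` ("the size of `f` near `y`", e.g.
`sup_{x∈Δ(y)}|f(x)|`, `sup_{x∈Δ(y)}|∇f(x)|`) and a base block `y₀`: the `BlockNorm` with `loc y = p y` and the trivial partition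
of unity `cut y₀ = id`, `cut y = 0` (`y ≠ y₀`), `IsLoc y f ↔ (y = y₀ ∨ f = 0)`, `κ = 1`.  The partition of an OUTPUT size is
never used by `HasMaj`/`Ineq190` or their consumers (see the module docstring), so this loses nothing.
[cite: Balaban1985Variational, (190) p.308] -/
noncomputable def ofSeminorms (g : B6.Geometry) (y₀ : g.Site) (p : g.Site → Seminorm ℝ F) : BlockNorm g F where
  loc y f := p y f
  cut y := (if y = y₀ then (1 : ℝ) else 0) • LinearMap.id
  IsLoc y f := y = y₀ ∨ f = 0
  κ := 1
  κ_nonneg := zero_le_one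
  loc_nonneg y f := apply_nonneg (p y) f
  loc_zero y := map_zero (p y)
  loc_add_le y f f' := map_add_le_add (p y) f f'
  loc_neg y f := map_neg_eq_map (p y) f
  sum_cut f := by
    rw [Finset.sum_eq_single y₀ (fun y _ hy => by simp [hy]) (fun h => absurd (Finset.mem_univ y₀) h)]
    simp
  isLoc_cut y f := by
    by_cases h : y = y₀
    · exact Or.inl h
    · right
      simp [h]
  loc_cut_le y f := by
    by_cases h : y = y₀
    · simp [h]
    · simp [h]

variable {y₀ : g.Site} {p : g.Site → Seminorm ℝ F}

/-- Unfolding: `(ofSeminorms g y₀ p).loc y f = p y f`. [cite: Balaban1985Variational, (190) p.308] -/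
@[simp] theorem ofSeminorms_loc (y : g.Site) (f : F) : (ofSeminorms g y₀ p).loc y f = p y f := rfl

/-- Unfolding: `(ofSeminorms g y₀ p).κ = 1`. [cite: Balaban1985Variational, (190) p.308] -/
@[simp] theorem ofSeminorms_κ : (ofSeminorms g y₀ p).κ = 1 := rfl

/-- THE DICTIONARY LEMMA for a finite sup of seminorms: with `p y = (S y).sup q`, every member is dominated —
`i ∈ S y → q i f ≤ (ofSeminorms g y₀ p).loc y f`. [cite: Balaban1985Variational, (190) p.308] -/
theorem le_ofSeminorms_sup_loc {ι : Type*} {S : g.Site → Finset ι} {q : ι → Seminorm ℝ F} {y : g.Site} {i : ι}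
    (hi : i ∈ S y) (f : F) :
    q i f ≤ (ofSeminorms g y₀ (fun y => (S y).sup q)).loc y f :=
  Seminorm.le_finset_sup_apply hi

end OfSeminorms

/-! ## §2 The first-order output size on the `ℤ^d` carriers: the covariant derivative of [14] (1.1) -/

section CovDeriv

variable {d : ℕ}
variable {𝔸 : Type} [NormedRing 𝔸] [NormedAlgebra ℂ 𝔸]

/-- **[14] (1.1): `f ↦ (∇^ξ_{U₀,μ} f_ν)(x)` is `ℝ`-linear in the bond field at a fixed background** — the forward covariant
derivative `ξ⁻¹(R(U₀(x,x+e_μ))f_ν(x+e_μ) − f_ν(x))` of `B8Ineq132.covDerivFwd` packaged as a linear functional of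
`f : Site d → Fin d → 𝔸`, indexed by the derivative point `t = (x, μ, ν)`. [cite: Balaban1985RegularSpaces, (1.1) p.76] -/
noncomputable def covDerivFwdLM (ξ : ℝ) (U₀ : B7Prop1Explicit.Site d → Fin d → 𝔸ˣ)
    (t : B7Prop1Explicit.Site d × Fin d × Fin d) : (B7Prop1Explicit.Site d → Fin d → 𝔸) →ₗ[ℝ] 𝔸 where
  toFun f := B8Ineq132.covDerivFwd ξ U₀ t.2.1 (fun z => f z t.2.2) t.1
  map_add' f f' := by
    simp only [B8Ineq132.covDerivFwd, B7Eq78Linearization.conjR_apply, Pi.add_apply, mul_add, add_mul, smul_add,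
      smul_sub]
    abel
  map_smul' c f := by
    simp only [B8Ineq132.covDerivFwd, B7Eq78Linearization.conjR_apply, Pi.smul_apply, RingHom.id_apply, mul_smul_comm,
      smul_mul_assoc, smul_sub, smul_smul, mul_comm c ξ⁻¹]

/-- Unfolding. [cite: Balaban1985RegularSpaces, (1.1) p.76] -/
theorem covDerivFwdLM_apply (ξ : ℝ) (U₀ : B7Prop1Explicit.Site d → Fin d → 𝔸ˣ)
    (t : B7Prop1Explicit.Site d × Fin d × Fin d) (f : B7Prop1Explicit.Site d → Fin d → 𝔸) :
    covDerivFwdLM ξ U₀ t f = B8Ineq132.covDerivFwd ξ U₀ t.2.1 (fun z => f z t.2.2) t.1 := rfl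

/-- The seminorm `f ↦ ‖(∇^ξ_{U₀,μ} f_ν)(x)‖` of one derivative point. [cite: Balaban1985Variational, (190) p.308] -/
noncomputable def covDerivSeminorm (ξ : ℝ) (U₀ : B7Prop1Explicit.Site d → Fin d → 𝔸ˣ)
    (t : B7Prop1Explicit.Site d × Fin d × Fin d) : Seminorm ℝ (B7Prop1Explicit.Site d → Fin d → 𝔸) :=
  (normSeminorm ℝ 𝔸).comp (covDerivFwdLM ξ U₀ t)

/-- Unfolding: `covDerivSeminorm ξ U₀ (x, μ, ν) f = ‖(∇^ξ_{U₀,μ} f_ν)(x)‖`. [cite: Balaban1985Variational, (190) p.308] -/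
theorem covDerivSeminorm_apply (ξ : ℝ) (U₀ : B7Prop1Explicit.Site d → Fin d → 𝔸ˣ)
    (t : B7Prop1Explicit.Site d × Fin d × Fin d) (f : B7Prop1Explicit.Site d → Fin d → 𝔸) :
    covDerivSeminorm ξ U₀ t f = ‖B8Ineq132.covDerivFwd ξ U₀ t.2.1 (fun z => f z t.2.2) t.1‖ := rfl

/-- **The first-order size of (190) on a finite set of derivative points**: `max_{(x,μ,ν)∈S} ‖(∇^ξ_{U₀,μ} f_ν)(x)‖` as a
`Seminorm`. [cite: Balaban1985Variational, (190) p.308] -/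
noncomputable def covDerivSize (S : Finset (B7Prop1Explicit.Site d × Fin d × Fin d)) (ξ : ℝ)
    (U₀ : B7Prop1Explicit.Site d → Fin d → 𝔸ˣ) : Seminorm ℝ (B7Prop1Explicit.Site d → Fin d → 𝔸) :=
  S.sup fun t => covDerivSeminorm ξ U₀ t

/-- Every derivative point of `S` is dominated: `(x, μ, ν) ∈ S → ‖(∇^ξ_{U₀,μ} f_ν)(x)‖ ≤ covDerivSize S ξ U₀ f`.
[cite: Balaban1985Variational, (190) p.308] -/
theorem norm_covDerivFwd_le_covDerivSize {S : Finset (B7Prop1Explicit.Site d × Fin d × Fin d)} {ξ : ℝ}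
    {U₀ : B7Prop1Explicit.Site d → Fin d → 𝔸ˣ} {x : B7Prop1Explicit.Site d} {μ ν : Fin d} (ht : (x, μ, ν) ∈ S)
    (f : B7Prop1Explicit.Site d → Fin d → 𝔸) :
    ‖B8Ineq132.covDerivFwd ξ U₀ μ (fun z => f z ν) x‖ ≤ covDerivSize S ξ U₀ f :=
  Seminorm.le_finset_sup_apply (p := fun t => covDerivSeminorm ξ U₀ t) ht

variable {g : B6.Geometry}

/-- **THE FIRST-ORDER OUTPUT SIZE OF (190) ON THE `ℤ^d` CARRIERS** — *"|∇_x(δ/δB)𝓗(B,x)| … for x ∈ Δ(y)"*: the `BlockNorm` with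
`loc y f = max_{(x,μ,ν) ∈ S y} ‖(∇^ξ_{U₀,μ} f_ν)(x)‖` for a finite set `S y` of derivative points per block (print: those of
Δ(y); for the (3.7)/(3.8) consumer: the two of the plaquette `p`), the covariant derivative taken at the FIXED background `U₀`
(print (3.7): `∇^η_{U_{k+1,□′}}`), trivial partition, κ = 1. [cite: Balaban1985Variational, (190) p.308] -/
noncomputable def covDerivBlockSize (g : B6.Geometry) (y₀ : g.Site)
    (S : g.Site → Finset (B7Prop1Explicit.Site d × Fin d × Fin d)) (ξ : ℝ) (U₀ : B7Prop1Explicit.Site d → Fin d → 𝔸ˣ) :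
    BlockNorm g (B7Prop1Explicit.Site d → Fin d → 𝔸) :=
  ofSeminorms g y₀ fun y => covDerivSize (S y) ξ U₀

/-- **THE DICTIONARY LEMMA (derivative size)**: `(x, μ, ν) ∈ S y → ‖(∇^ξ_{U₀,μ} f_ν)(x)‖ ≤ (covDerivBlockSize g y₀ S ξ U₀).loc y f`
— exactly the shape `‖covDerivFwd ξ U₀ μ (fun z => H z ν) x‖ ≤ bout₁.loc y HB` of the consumers' hypothesis `hdomD`.
[cite: Balaban1985Variational, (190) p.308] -/
theorem norm_covDerivFwd_le_loc {y₀ : g.Site} {S : g.Site → Finset (B7Prop1Explicit.Site d × Fin d × Fin d)} {ξ : ℝ}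
    {U₀ : B7Prop1Explicit.Site d → Fin d → 𝔸ˣ} {y : g.Site} {x : B7Prop1Explicit.Site d} {μ ν : Fin d}
    (ht : (x, μ, ν) ∈ S y) (f : B7Prop1Explicit.Site d → Fin d → 𝔸) :
    ‖B8Ineq132.covDerivFwd ξ U₀ μ (fun z => f z ν) x‖ ≤ (covDerivBlockSize g y₀ S ξ U₀).loc y f :=
  norm_covDerivFwd_le_covDerivSize ht f

end CovDeriv

end Literature.MathematicalPhysics.QuantumFieldTheory.Balaban1983to89.B11SeminormSize190
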